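import Mathlib
import Summits.ValiantsHypothesis.ValiantsHypothesis.Theorems.NewtonUnitEquationsNewtonTauWeakCornerRigidity

/-!
# `NewtonTauWeak` (stmt-ValiantsHypothesis-5904), sub-stub `fixedKCoincidence_t2_K3`: separated products in
# `MvPolynomial (Fin 2) ℂ` versus the fibre sums of the corner model

Support file (siege attempt, line-cover route) for the `K = 3` fixed-coincidence rung of the open stub
`stub_binomialNewtonTauCommon` (KPTT arXiv:1308.2286 Conj. 1 at `t = 2`).  It links the abstract CORNER MODEL of
`Theorems/NewtonUnitEquationsNewtonTauWeakCornerDefs.lean` (`push`, `sepCoeff`, `box`, `fibreSum`, `wt`, `IsOrder`)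
to honest bivariate polynomials: a SEPARATED PRODUCT is `Π_e U_e(X^{g_e})` for directions `g_e ∈ ℕ²` and
univariate `U_e ∈ ℂ[s]`, realised as `∏ e, Polynomial.aeval (monomial (g e) 1) (U e)`.

Main results (all [folklore]):
* `sepProd_eq_sum`, `coeff_sepProd` — the coefficient of `X^x` in a separated product is the fibre sum
  `Σ_{n ∈ box, Σ_e n_e g_e = x} Π_e [s^{n_e}] U_e` (coinciding words allowed);
* `k3l_fibreSum_eq_coeff` — the corner model's `fibreSum` IS the coefficient function of `κ₁ Π U + κ₂ Π W`;
* `strictMin_mul` — a strict `w`-minimal exponent survives multiplication by a factor with nonzero constant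
  term whose other exponents have positive weight (real weights `wt`);
* `exists_truncInv` — truncated inverse of a univariate polynomial with constant term `1`;
* `isOrder_sub_of_isOrder_mul_truncInv` — after multiplying by the truncated inverse of `Q`, the corner order of
  `P · V` is the order of `P − Q`.
-/

set_option linter.dupNamespace false

noncomputable section

open scoped BigOperators Polynomial
open MvPolynomial
open Summit.ValiantsHypothesis.ValiantsHypothesis.Theorems.NewtonTauWeakCorner

namespace Summit.ValiantsHypothesis.ValiantsHypothesis.Theorems.NewtonTauWeakK3Lines

/-! ## §1 Separated products: the word expansion and the coefficient formula -/

/-- Substituting the monomial `X^g` into a univariate polynomial of degree `≤ D`: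
`P(X^g) = Σ_{k ≤ D} [s^k]P · X^{k g}`. [folklore] -/
theorem aeval_monomial_eq_sum (g : Fin 2 →₀ ℕ) (P : ℂ[X]) {D : ℕ} (hP : P.natDegree ≤ D) :
    Polynomial.aeval (monomial g (1 : ℂ)) P =
      ∑ k ∈ Finset.range (D + 1), monomial (k • g) (P.coeff k) := by
  rw [Polynomial.aeval_eq_sum_range' (Nat.lt_succ_of_le hP)]
  refine Finset.sum_congr rfl fun k _ => ?_
  rw [monomial_pow, one_pow, MvPolynomial.smul_eq_C_mul, C_mul_monomial, mul_one]

/-- **Word expansion of a separated product**: `Π_e U_e(X^{g_e}) = Σ_{n ∈ box} (Π_e [s^{n_e}]U_e) X^{Σ_e n_e g_e}`.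
[folklore] -/
theorem sepProd_eq_sum {s D : ℕ} (g : Fin s → (Fin 2 →₀ ℕ)) (U : Fin s → ℂ[X])
    (hU : ∀ e, (U e).natDegree ≤ D) :
    (∏ e, Polynomial.aeval (monomial (g e) (1 : ℂ)) (U e)) =
      ∑ n ∈ box s D, monomial (∑ e, n e • g e) (sepCoeff U n) := by
  have h1 : (∏ e, Polynomial.aeval (monomial (g e) (1 : ℂ)) (U e)) =
      ∏ e, ∑ k ∈ Finset.range (D + 1), monomial (k • g e) ((U e).coeff k) :=
    Finset.prod_congr rfl fun e _ => aeval_monomial_eq_sum (g e) (U e) (hU e)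
  rw [h1, Finset.prod_univ_sum]
  refine Finset.sum_congr rfl fun n _ => ?_
  unfold sepCoeff
  exact (monomial_sum_prod Finset.univ (fun e => n e • g e) fun e => (U e).coeff (n e)).symm

/-- **Coefficient formula**: the coefficient of `X^x` in `Π_e U_e(X^{g_e})` is the fibre sum of the separated
coefficients over the words of the box pushing forward to `x`. [folklore] -/
theorem coeff_sepProd {s D : ℕ} (g : Fin s → (Fin 2 →₀ ℕ)) (U : Fin s → ℂ[X])
    (hU : ∀ e, (U e).natDegree ≤ D) (x : Fin 2 →₀ ℕ) :
    coeff x (∏ e, Polynomial.aeval (monomial (g e) (1 : ℂ)) (U e)) =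
      ∑ n ∈ (box s D).filter (fun n => ∑ e, n e • g e = x), sepCoeff U n := by
  classical
  rw [sepProd_eq_sum g U hU, coeff_sum, Finset.sum_filter]
  refine Finset.sum_congr rfl fun n _ => ?_
  rw [coeff_monomial]

/-- The constant term of a separated product of polynomials with constant term `1` is `1`. [folklore] -/
theorem coeff_zero_sepProd {s : ℕ} (g : Fin s → (Fin 2 →₀ ℕ)) (hg : ∀ e, g e ≠ 0) (U : Fin s → ℂ[X])
    (hU0 : ∀ e, (U e).coeff 0 = 1) :
    coeff 0 (∏ e, Polynomial.aeval (monomial (g e) (1 : ℂ)) (U e)) = 1 := by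
  classical
  obtain ⟨D, hD⟩ : ∃ D, ∀ e, (U e).natDegree ≤ D :=
    ⟨Finset.univ.sup fun e => (U e).natDegree, fun e =>
      Finset.le_sup (f := fun e => (U e).natDegree) (Finset.mem_univ e)⟩
  rw [coeff_sepProd g U hD]
  rw [Finset.sum_eq_single_of_mem (0 : Fin s → ℕ)]
  · unfold sepCoeff
    simp [hU0]
  · refine Finset.mem_filter.mpr ⟨?_, by simp⟩
    unfold box
    exact Fintype.mem_piFinset.mpr fun _ => Finset.mem_range.mpr (Nat.succ_pos D)
  · intro n hn hne
    exfalso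
    obtain ⟨-, hsum⟩ := Finset.mem_filter.mp hn
    obtain ⟨e, he⟩ : ∃ e, n e ≠ 0 := by
      by_contra h
      push Not at h
      exact hne (funext h)
    have hle : n e • g e ≤ ∑ e', n e' • g e' :=
      Finset.single_le_sum (f := fun e' => n e' • g e') (fun e' _ => by positivity) (Finset.mem_univ e)
    rw [hsum] at hle
    have h0 : n e • g e = 0 := le_antisymm hle bot_le
    rcases smul_eq_zero.mp h0 with h | h
    · exact he h
    · exact hg e h

/-! ## §2 Casting exponents to `ℤ²`: `push` and `fibreSum` versus coefficients -/

/-- The push-forward of a word along the cast directions is the cast of the exponent `Σ_e n_e g_e`. [folklore] -/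
theorem push_cast_eq {s : ℕ} (g : Fin s → (Fin 2 →₀ ℕ)) (n : Fin s → ℕ) :
    push (fun e i => (g e i : ℤ)) n = fun i => (((∑ e, n e • g e : Fin 2 →₀ ℕ)) i : ℤ) := by
  funext i
  unfold push
  rw [Finset.sum_apply, Finsupp.finsetSum_apply]
  push_cast
  refine Finset.sum_congr rfl fun e _ => ?_
  simp

/-- Casting exponents is injective. [folklore] -/
theorem cast_injective : Function.Injective (fun x : Fin 2 →₀ ℕ => fun i : Fin 2 => (x i : ℤ)) := by
  intro x y h
  ext i
  have hi : (x i : ℤ) = (y i : ℤ) := congrFun h i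
  exact_mod_cast hi

/-- The word filter of the corner model (cast directions, cast point) is the word filter of the polynomial model.
[folklore] -/
theorem filter_push_eq {s D : ℕ} (g : Fin s → (Fin 2 →₀ ℕ)) (x : Fin 2 →₀ ℕ) :
    (box s D).filter (fun n => push (fun e i => (g e i : ℤ)) n = fun i => (x i : ℤ)) =
      (box s D).filter (fun n => ∑ e, n e • g e = x) := by
  refine Finset.filter_congr fun n _ => ?_
  rw [push_cast_eq]
  constructor
  · intro h; exact cast_injective h
  · intro h; rw [h]

/-- **`fibreSum` is the coefficient function.**  For cast directions and a cast point, the corner model's fibre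
sum of `κ₁ ⊗U + κ₂ ⊗W` is the coefficient of `κ₁ Π_e U_e(X^{g_e}) + κ₂ Π_e W_e(X^{g_e})`. [folklore] -/
theorem k3l_fibreSum_eq_coeff {s D : ℕ} (g : Fin s → (Fin 2 →₀ ℕ)) (κ₁ κ₂ : ℂ) (U W : Fin s → ℂ[X])
    (hU : ∀ e, (U e).natDegree ≤ D) (hW : ∀ e, (W e).natDegree ≤ D) (x : Fin 2 →₀ ℕ) :
    fibreSum (fun e i => (g e i : ℤ)) D κ₁ κ₂ U W (fun i => (x i : ℤ)) =
      coeff x (C κ₁ * ∏ e, Polynomial.aeval (monomial (g e) (1 : ℂ)) (U e) +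
        C κ₂ * ∏ e, Polynomial.aeval (monomial (g e) (1 : ℂ)) (W e)) := by
  classical
  unfold fibreSum
  rw [filter_push_eq, coeff_add, coeff_C_mul, coeff_C_mul, coeff_sepProd g U hU, coeff_sepProd g W hW,
    Finset.mul_sum, Finset.mul_sum, ← Finset.sum_add_distrib]

/-- At a point of `ℤ²` that is not a cast exponent the fibre sum vanishes (no word pushes there). [folklore] -/
theorem fibreSum_eq_zero_of_not_cast {s D : ℕ} (g : Fin s → (Fin 2 →₀ ℕ)) (κ₁ κ₂ : ℂ) (U W : Fin s → ℂ[X])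
    (v : Fin 2 → ℤ) (hv : ∀ x : Fin 2 →₀ ℕ, (fun i => (x i : ℤ)) ≠ v) :
    fibreSum (fun e i => (g e i : ℤ)) D κ₁ κ₂ U W v = 0 := by
  classical
  unfold fibreSum
  refine Finset.sum_eq_zero fun n hn => ?_
  exfalso
  obtain ⟨-, hpush⟩ := Finset.mem_filter.mp hn
  rw [push_cast_eq] at hpush
  exact hv _ hpush

/-! ## §3 Real weights on exponents -/

/-- Additivity of the real weight on cast exponents. [folklore] -/
theorem wt_cast_add (w : Fin 2 → ℝ) (x y : Fin 2 →₀ ℕ) :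
    wt w (fun i => ((x + y : Fin 2 →₀ ℕ) i : ℤ)) = wt w (fun i => (x i : ℤ)) + wt w (fun i => (y i : ℤ)) := by
  simp only [wt, Finsupp.add_apply, Nat.cast_add, Int.cast_add, Int.cast_natCast]
  ring

/-- The real weight of a cast multiple. [folklore] -/
theorem wt_cast_smul (w : Fin 2 → ℝ) (k : ℕ) (x : Fin 2 →₀ ℕ) :
    wt w (fun i => ((k • x : Fin 2 →₀ ℕ) i : ℤ)) = (k : ℝ) * wt w (fun i => (x i : ℤ)) := by
  simp only [wt, Finsupp.smul_apply, smul_eq_mul, Nat.cast_mul, Int.cast_mul, Int.cast_natCast]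
  ring

/-- The cast of the zero exponent has weight `0`. [folklore] -/
theorem wt_cast_zero (w : Fin 2 → ℝ) : wt w (fun i => ((0 : Fin 2 →₀ ℕ) i : ℤ)) = 0 := by
  simp [wt]

/-- The weight of a cast word sum. [folklore] -/
theorem wt_cast_wordSum {s : ℕ} (w : Fin 2 → ℝ) (g : Fin s → (Fin 2 →₀ ℕ)) (n : Fin s → ℕ) :
    wt w (fun i => ((∑ e, n e • g e : Fin 2 →₀ ℕ) i : ℤ)) = ∑ e, (n e : ℝ) * wt w (fun i => (g e i : ℤ)) := by
  rw [← push_cast_eq, wt_push]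

/-- A nonzero word over directions of positive weight pushes to a point of positive weight. [folklore] -/
theorem wt_cast_wordSum_pos {s : ℕ} (w : Fin 2 → ℝ) (g : Fin s → (Fin 2 →₀ ℕ))
    (hpos : ∀ e, 0 < wt w (fun i => (g e i : ℤ))) (n : Fin s → ℕ) (hn : n ≠ 0) :
    0 < wt w (fun i => ((∑ e, n e • g e : Fin 2 →₀ ℕ) i : ℤ)) := by
  rw [wt_cast_wordSum]
  obtain ⟨e, he⟩ : ∃ e, n e ≠ 0 := by
    by_contra h
    push Not at h
    exact hn (funext h)
  have hle : (n e : ℝ) * wt w (fun i => (g e i : ℤ)) ≤ ∑ e', (n e' : ℝ) * wt w (fun i => (g e' i : ℤ)) :=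
    Finset.single_le_sum (f := fun e' => (n e' : ℝ) * wt w (fun i => (g e' i : ℤ)))
      (fun e' _ => mul_nonneg (Nat.cast_nonneg _) (hpos e').le) (Finset.mem_univ e)
  have hlt : 0 < (n e : ℝ) * wt w (fun i => (g e i : ℤ)) :=
    mul_pos (by exact_mod_cast Nat.pos_of_ne_zero he) (hpos e)
  linarith

/-- Every nonzero exponent of a separated product has positive weight (directions of positive weight).
[folklore] -/
theorem wt_pos_of_mem_support_sepProd {s : ℕ} (w : Fin 2 → ℝ) (g : Fin s → (Fin 2 →₀ ℕ))
    (hpos : ∀ e, 0 < wt w (fun i => (g e i : ℤ))) (U : Fin s → ℂ[X]) {y : Fin 2 →₀ ℕ}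
    (hy : y ∈ (∏ e, Polynomial.aeval (monomial (g e) (1 : ℂ)) (U e)).support) (hy0 : y ≠ 0) :
    0 < wt w (fun i => (y i : ℤ)) := by
  classical
  obtain ⟨D, hD⟩ : ∃ D, ∀ e, (U e).natDegree ≤ D :=
    ⟨Finset.univ.sup fun e => (U e).natDegree, fun e =>
      Finset.le_sup (f := fun e => (U e).natDegree) (Finset.mem_univ e)⟩
  rw [mem_support_iff, coeff_sepProd g U hD] at hy
  obtain ⟨n, hn, -⟩ := Finset.exists_ne_zero_of_sum_ne_zero hy
  obtain ⟨-, hsum⟩ := Finset.mem_filter.mp hn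
  rw [← hsum]
  refine wt_cast_wordSum_pos w g hpos n ?_
  rintro rfl
  apply hy0
  rw [← hsum]
  simp

/-! ## §4 Strict minima of supports under multiplication -/

/-- **A strict `w`-minimal exponent survives multiplication by a unit-like factor.**  If `x` is the unique
`w`-lightest exponent of `A`, and every nonzero exponent of `B` has positive weight, then the coefficient of `x` in
`A · B` is `[x]A · [0]B`, and if `[0]B ≠ 0` then `x` is the unique `w`-lightest exponent of `A · B`. [folklore] -/
theorem coeff_mul_of_strictMin (w : Fin 2 → ℝ) (A B : MvPolynomial (Fin 2) ℂ) (x : Fin 2 →₀ ℕ)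
    (hmin : ∀ y ∈ A.support, y ≠ x → wt w (fun i => (x i : ℤ)) < wt w (fun i => (y i : ℤ)))
    (hB : ∀ y ∈ B.support, y ≠ 0 → 0 < wt w (fun i => (y i : ℤ))) :
    coeff x (A * B) = coeff x A * coeff 0 B := by
  classical
  rw [coeff_mul, Finset.sum_eq_single_of_mem (x, 0) (by simp)]
  rintro ⟨a, b⟩ hab hne
  have hab' : a + b = x := Finset.HasAntidiagonal.mem_antidiagonal.mp hab
  have hb0 : b ≠ 0 := by
    rintro rfl
    rw [add_zero] at hab'
    exact hne (by rw [hab'])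
  by_cases hbB : b ∈ B.support
  · by_cases haA : a ∈ A.support
    · exfalso
      have hax : a ≠ x := by
        rintro rfl
        apply hb0
        have : a + b = a + 0 := by rw [hab', add_zero]
        exact add_left_cancel this
      have h1 := hmin a haA hax
      have h2 := hB b hbB hb0
      have h3 : wt w (fun i => (x i : ℤ)) = wt w (fun i => (a i : ℤ)) + wt w (fun i => (b i : ℤ)) := by
        rw [← hab', wt_cast_add]
      linarith
    · rw [notMem_support_iff.mp haA, zero_mul]
  · rw [notMem_support_iff.mp hbB, mul_zero]

/-- Strict minimality transfers to the product (same hypotheses, `[0]B ≠ 0`, `[x]A ≠ 0`). [folklore] -/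
theorem strictMin_mul (w : Fin 2 → ℝ) (A B : MvPolynomial (Fin 2) ℂ) (x : Fin 2 →₀ ℕ)
    (hx : x ∈ A.support)
    (hmin : ∀ y ∈ A.support, y ≠ x → wt w (fun i => (x i : ℤ)) < wt w (fun i => (y i : ℤ)))
    (hB0 : coeff 0 B ≠ 0) (hB : ∀ y ∈ B.support, y ≠ 0 → 0 < wt w (fun i => (y i : ℤ))) :
    x ∈ (A * B).support ∧
      ∀ y ∈ (A * B).support, y ≠ x → wt w (fun i => (x i : ℤ)) < wt w (fun i => (y i : ℤ)) := by
  classical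
  constructor
  · rw [mem_support_iff, coeff_mul_of_strictMin w A B x hmin hB]
    exact mul_ne_zero (mem_support_iff.mp hx) hB0
  · intro y hy hyx
    obtain ⟨a, ha, b, hb, rfl⟩ := Finset.mem_add.mp (support_mul A B hy)
    rw [wt_cast_add]
    by_cases hax : a = x
    · subst hax
      have hb0 : b ≠ 0 := by rintro rfl; exact hyx (add_zero a)
      linarith [hB b hb hb0]
    · have h1 := hmin a ha hax
      by_cases hb0 : b = 0
      · subst hb0; rw [wt_cast_zero, add_zero]; exact h1
      · linarith [hB b hb hb0]

/-- Coefficients of a product below a weight bound only see coefficients of the left factor below that bound,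
when the right factor's nonzero exponents have positive weight: congruence below a bound is preserved.
[folklore] -/
theorem coeff_mul_congr_of_wt_le (w : Fin 2 → ℝ) (A A' B : MvPolynomial (Fin 2) ℂ) (β : ℝ)
    (hB : ∀ y ∈ B.support, y ≠ 0 → 0 < wt w (fun i => (y i : ℤ)))
    (hA : ∀ y, wt w (fun i => (y i : ℤ)) ≤ β → coeff y A = coeff y A') (x : Fin 2 →₀ ℕ)
    (hx : wt w (fun i => (x i : ℤ)) ≤ β) : coeff x (A * B) = coeff x (A' * B) := by
  classical
  rw [coeff_mul, coeff_mul]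
  refine Finset.sum_congr rfl fun ab hab => ?_
  have hab' : ab.1 + ab.2 = x := Finset.HasAntidiagonal.mem_antidiagonal.mp hab
  by_cases hbB : ab.2 ∈ B.support
  · have hb : 0 ≤ wt w (fun i => (ab.2 i : ℤ)) := by
      by_cases hb0 : ab.2 = 0
      · rw [hb0, wt_cast_zero]
      · exact (hB _ hbB hb0).le
    have ha : wt w (fun i => (ab.1 i : ℤ)) ≤ β := by
      have : wt w (fun i => (x i : ℤ)) = wt w (fun i => (ab.1 i : ℤ)) + wt w (fun i => (ab.2 i : ℤ)) := by
        rw [← hab', wt_cast_add]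
      linarith
    rw [hA _ ha]
  · rw [notMem_support_iff.mp hbB, mul_zero, mul_zero]

/-! ## §5 Truncated inverses of univariate polynomials with constant term `1` -/

/-- **Truncated inverse.** A univariate polynomial `Q` with `Q(0) = 1` has, for every `D`, a polynomial `V` with
`V(0) = 1`, `deg V ≤ D` and `Q · V ≡ 1 (mod s^{D+1})`. [folklore] -/
theorem exists_truncInv (Q : ℂ[X]) (hQ : Q.coeff 0 = 1) (D : ℕ) :
    ∃ V : ℂ[X], V.coeff 0 = 1 ∧ V.natDegree ≤ D ∧ ∀ k, 1 ≤ k → k ≤ D → (Q * V).coeff k = 0 := by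
  induction D with
  | zero =>
    refine ⟨1, by simp, by simp, fun k hk hk0 => by omega⟩
  | succ D ih =>
    obtain ⟨V, hV0, hVD, hVk⟩ := ih
    -- correct the coefficient of degree `D + 1`
    set a : ℂ := (Q * V).coeff (D + 1) with ha
    refine ⟨V - Polynomial.C a * Polynomial.X ^ (D + 1), ?_, ?_, ?_⟩
    · rw [Polynomial.coeff_sub, Polynomial.coeff_C_mul, Polynomial.coeff_X_pow, if_neg (by omega), mul_zero,
        sub_zero, hV0]
    · refine (Polynomial.natDegree_sub_le _ _).trans (max_le (hVD.trans (Nat.le_succ D)) ?_)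
      exact (Polynomial.natDegree_C_mul_le _ _).trans (Polynomial.natDegree_X_pow_le _)
    · intro k hk1 hkD
      rw [mul_sub, Polynomial.coeff_sub, ← mul_assoc, Polynomial.coeff_mul_X_pow', Polynomial.coeff_mul_C]
      rcases Nat.lt_or_ge k (D + 1) with hlt | hge
      · rw [hVk k hk1 (by omega), if_neg (by omega), sub_zero]
      · have hkeq : k = D + 1 := le_antisymm hkD hge
        subst hkeq
        rw [if_pos le_rfl, Nat.sub_self, hQ, one_mul, ← ha, sub_self]

/-- Orders at the corner ignore the constant term. [folklore] -/
theorem isOrder_congr {P P' : ℂ[X]} (h : ∀ j, 1 ≤ j → P.coeff j = P'.coeff j) {k : ℕ} (hk : IsOrder P k) :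
    IsOrder P' k := by
  obtain ⟨hk1, hkc, hkz⟩ := hk
  refine ⟨hk1, by rwa [← h k hk1], fun j hj hjk => ?_⟩
  rw [← h j hj]
  exact hkz j hj hjk

/-- The order of a product with a polynomial of constant term `1` is the order of the first factor (for a factor
without constant term). [folklore] -/
theorem isOrder_mul_of_isOrder {R V : ℂ[X]} (hR0 : R.coeff 0 = 0) (hV0 : V.coeff 0 = 1) {k : ℕ}
    (hk : IsOrder R k) : IsOrder (R * V) k := by
  obtain ⟨hk1, hkc, hkz⟩ := hk
  have hlow : ∀ j, j < k → R.coeff j = 0 := by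
    intro j hj
    rcases Nat.eq_zero_or_pos j with h0 | hpos
    · rw [h0]; exact hR0
    · exact hkz j hpos hj
  refine ⟨hk1, ?_, ?_⟩
  · rw [Polynomial.coeff_mul, Finset.Nat.sum_antidiagonal_eq_sum_range_succ_mk, Finset.sum_range_succ,
      Finset.sum_eq_zero, zero_add, Nat.sub_self, hV0, mul_one]
    · exact hkc
    · intro j hj
      rw [hlow j (Finset.mem_range.mp hj), zero_mul]
  · intro j hj hjk
    rw [Polynomial.coeff_mul, Finset.Nat.sum_antidiagonal_eq_sum_range_succ_mk]
    refine Finset.sum_eq_zero fun i hi => ?_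
    rw [hlow i (by have := Finset.mem_range.mp hi; omega), zero_mul]

/-- A nonzero polynomial without constant term has an order. [folklore] -/
theorem exists_isOrder_of_ne_zero {R : ℂ[X]} (hR0 : R.coeff 0 = 0) (hR : R ≠ 0) : ∃ k, IsOrder R k := by
  apply exists_isOrder
  by_contra h
  push Not at h
  apply hR
  ext j
  rw [Polynomial.coeff_zero]
  rcases Nat.eq_zero_or_pos j with h0 | hpos
  · rw [h0, hR0]
  · exact h j hpos

/-- **Order transfer through the truncated inverse.**  Let `P(0) = Q(0) = 1`, `deg P, deg Q ≤ D`, `P ≠ Q`, and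
`Q · V ≡ 1 (mod s^{D+1})` with `V(0) = 1`.  Then the corner order of `P · V` is the order of `P − Q` (in
particular it is at most `D`). [folklore] -/
theorem isOrder_sub_of_isOrder_mul_truncInv {P Q V : ℂ[X]} {D : ℕ} (hP0 : P.coeff 0 = 1) (hQ0 : Q.coeff 0 = 1)
    (hPD : P.natDegree ≤ D) (hQD : Q.natDegree ≤ D) (hPQ : P ≠ Q) (hV0 : V.coeff 0 = 1)
    (hQV : ∀ k, 1 ≤ k → k ≤ D → (Q * V).coeff k = 0) {k : ℕ} (hk : IsOrder (P * V) k) :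
    IsOrder (P - Q) k := by
  -- the order `k₀` of `P - Q` exists and is `≤ D`
  have hR0 : (P - Q).coeff 0 = 0 := by rw [Polynomial.coeff_sub, hP0, hQ0, sub_self]
  obtain ⟨k₀, hk₀⟩ := exists_isOrder_of_ne_zero hR0 (sub_ne_zero.mpr hPQ)
  have hk₀D : k₀ ≤ D := by
    refine hk₀.le_natDegree.trans ((Polynomial.natDegree_sub_le P Q).trans (max_le hPD hQD))
  -- `(P - Q) V` has order `k₀`, and agrees with `P V` in degrees `1 … D`
  have h1 : IsOrder ((P - Q) * V) k₀ := isOrder_mul_of_isOrder hR0 hV0 hk₀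
  have hagree : ∀ j, 1 ≤ j → j ≤ D → ((P - Q) * V).coeff j = (P * V).coeff j := by
    intro j hj1 hjD
    rw [sub_mul, Polynomial.coeff_sub, hQV j hj1 hjD, sub_zero]
  -- hence `P V` has order `k₀` as well (orders only look at degrees `≤ k₀ ≤ D`)
  have h2 : IsOrder (P * V) k₀ := by
    obtain ⟨h11, h1c, h1z⟩ := h1
    refine ⟨h11, by rwa [← hagree k₀ h11 hk₀D], fun j hj hjk => ?_⟩
    rw [← hagree j hj (by omega)]
    exact h1z j hj hjk
  rw [hk.unique h2]
  exact hk₀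

end Summit.ValiantsHypothesis.ValiantsHypothesis.Theorems.NewtonTauWeakK3Lines

end
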